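import Mathlib
import Literature.Analysis.FluidPDE.EnstrophySplittingDissipation
import Literature.Analysis.FluidPDE.WholeSpaceIBPIntegrable
import Summits.NavierStokesRegularity.NavierStokesRegularity.Theorems.LevelSetModerationLevelSetEnergyInequalityTruncation

/-!
# Route LevelSetModeration — `LevelSetEnergyInequality`: transport term and time balance (helper file 4)

Support lemmas for item stmt-NavierStokesRegularity-18151 (Vasseur 2007, Lemma 11, the steps
"the transport term integrates to zero" and "`d/dt ∫ (|u| - c)₊² = 2∫ (1 - c/|u|)₊ ⟪∂ₜu, u⟫`"
of the level-set energy inequality, in global form on `ℝ³`):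

* `integrable_slab_of_pairing_bound` — space–time integrability on `(0, T) × ℝ³` of a jointly
  continuous density dominated by the product of two fields with `L²` norms bounded in time;
* `transport_slice` — `∫ k₀(u) ⟪(u·∇)u, u⟫ = 0` for a bounded divergence-free `C¹` field with
  `u, Du ∈ L²` (`k₀(u)⟪(u·∇)u,u⟫ = ½ u·∇(|u|-c)₊²` and `div u = 0`);
* `truncSq_balance` — `∫(|u(T)|-c)₊² = ∫(|u(0)|-c)₊² + 2∫₀ᵀ∫ k₀(u)⟪∂ₜu, u⟫` for a jointly smooth
  field with `u, ∂ₜu ∈ L^∞_t L²_x` (fundamental theorem of calculus on time lines and Fubini).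

## References
* A. F. Vasseur, NoDEA 14 (2007), Lemma 11 and its proof. [Vasseur2007]
-/

noncomputable section

-- single-conjunct summit: `Summit.<Summit>.<Problem>` repeats the name by the D-0017 layout
set_option linter.dupNamespace false

namespace Summit.NavierStokesRegularity.NavierStokesRegularity.Theorems.LevelSetEnergyInequality

open Real Set Filter Topology MeasureTheory InnerProductSpace Function
open scoped RealInnerProductSpace ENNReal NNReal
open Literature.Analysis.FluidPDE

/-! ### Space–time integrability from slice `L²` bounds -/

/-- `|r| ≤ ‖a‖ ‖b‖ ⇒ ‖r‖ₑ ≤ ½ (‖a‖ₑ² + ‖b‖ₑ²)`. -/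
theorem enorm_le_half_add_sq {F₁ F₂ : Type*} [NormedAddCommGroup F₁] [NormedAddCommGroup F₂]
    {r : ℝ} {a : F₁} {b : F₂} (h : |r| ≤ ‖a‖ * ‖b‖) :
    ‖r‖ₑ ≤ (2⁻¹ : ℝ≥0∞) * (‖a‖ₑ ^ 2 + ‖b‖ₑ ^ 2) := by
  have hle : |r| ≤ 2⁻¹ * (‖a‖ ^ 2 + ‖b‖ ^ 2) := by
    nlinarith [sq_nonneg (‖a‖ - ‖b‖), h]
  have hR : (2⁻¹ : ℝ≥0∞) * (‖a‖ₑ ^ 2 + ‖b‖ₑ ^ 2) = ENNReal.ofReal (2⁻¹ * (‖a‖ ^ 2 + ‖b‖ ^ 2)) := by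
    rw [ENNReal.ofReal_mul (by norm_num), ENNReal.ofReal_inv_of_pos two_pos, ENNReal.ofReal_ofNat,
      ENNReal.ofReal_add (sq_nonneg _) (sq_nonneg _), ← ofReal_norm, ← ofReal_norm b,
      ENNReal.ofReal_pow (norm_nonneg _), ENNReal.ofReal_pow (norm_nonneg _)]
  rw [hR, Real.enorm_eq_ofReal_abs]
  exact ENNReal.ofReal_le_ofReal hle

/-- **Space–time integrability on `(0, T) × ℝ³` from slice `L²` bounds.** A density `g` jointly
continuous on `[0, T] × ℝ³` with `|g(t, x)| ≤ ‖a(t, x)‖ ‖b(t, x)‖`, where the slices of `a`, `b` are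
continuous with `∫ ‖a(t)‖² ≤ C_a`, `∫ ‖b(t)‖² ≤ C_b` on `[0, T]`, is integrable for `dt|_(0,T) ⊗ dx`
(Tonelli and `|g| ≤ ½(‖a‖² + ‖b‖²)`). -/
theorem integrable_slab_of_pairing_bound {F₁ F₂ : Type*} [NormedAddCommGroup F₁]
    [NormedAddCommGroup F₂] {T : ℝ} {g : ℝ × EuclideanSpace ℝ (Fin 3) → ℝ}
    {a : ℝ → EuclideanSpace ℝ (Fin 3) → F₁} {b : ℝ → EuclideanSpace ℝ (Fin 3) → F₂} {Ca Cb : ℝ≥0}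
    (hg : ContinuousOn g (Icc 0 T ×ˢ univ))
    (hle : ∀ t ∈ Icc 0 T, ∀ x, |g (t, x)| ≤ ‖a t x‖ * ‖b t x‖)
    (ha : ∀ t ∈ Icc 0 T, Continuous (a t))
    (hCa : ∀ t ∈ Icc 0 T, ∫⁻ x, ‖a t x‖ₑ ^ 2 ≤ Ca) (hCb : ∀ t ∈ Icc 0 T, ∫⁻ x, ‖b t x‖ₑ ^ 2 ≤ Cb) :
    Integrable g (((volume : Measure ℝ).restrict (Ioo 0 T)).prod volume) := by
  have hslice : ∀ t ∈ Icc 0 T, ∫⁻ x, ‖g (t, x)‖ₑ ≤ (2⁻¹ : ℝ≥0∞) * (Ca + Cb) := fun t ht => by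
    calc ∫⁻ x, ‖g (t, x)‖ₑ ≤ ∫⁻ x, (2⁻¹ : ℝ≥0∞) * (‖a t x‖ₑ ^ 2 + ‖b t x‖ₑ ^ 2) :=
          lintegral_mono fun x => enorm_le_half_add_sq (hle t ht x)
      _ = (2⁻¹ : ℝ≥0∞) * ((∫⁻ x, ‖a t x‖ₑ ^ 2) + ∫⁻ x, ‖b t x‖ₑ ^ 2) := by
          rw [lintegral_const_mul' _ _ (by simp), lintegral_add_left']
          exact (ha t ht).aestronglyMeasurable.enorm.pow_const _
      _ ≤ 2⁻¹ * (Ca + Cb) := by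
          gcongr
          · exact hCa t ht
          · exact hCb t ht
  refine integrable_prod_of_continuousOn_of_lintegral hg ?_
  calc ∫⁻ t in Ioo 0 T, ∫⁻ x, ‖g (t, x)‖ₑ ≤ ∫⁻ _ in Ioo 0 T, (2⁻¹ : ℝ≥0∞) * (Ca + Cb) :=
        setLIntegral_mono' measurableSet_Ioo fun t ht => hslice t (Ioo_subset_Icc_self ht)
    _ < ⊤ := by
        rw [setLIntegral_const]
        refine ENNReal.mul_lt_top (ENNReal.mul_lt_top (by simp) ?_) (by simp)
        exact ENNReal.add_lt_top.2 ⟨ENNReal.coe_lt_top, ENNReal.coe_lt_top⟩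

/-! ### The transport term vanishes -/

/-- **The transport term of the level-set energy balance vanishes** (Vasseur 2007, proof of
Lemma 11: `(1-c/|u|)₊ u·((u·∇)u) = u·∇[(|u|-c)₊²/2]` and `div u = 0`). For a bounded divergence-free
`C¹` field `u` on `ℝ³` with `u, Du ∈ L²` and `c > 0`:
`∫ k₀(u) ⟪Du(u), u⟫ = 0`, `k₀(u) = (|u|-c)₊/max(|u|,c)`. -/
theorem transport_slice {c : ℝ} (hc : 0 < c)
    {u : EuclideanSpace ℝ (Fin 3) → EuclideanSpace ℝ (Fin 3)} (hu : ContDiff ℝ 1 u)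
    (hdiv : VectorCalculus.IsDivFree u) {B : ℝ} (hB : ∀ x, ‖u x‖ ≤ B)
    (h0 : ∫⁻ x, ‖u x‖ₑ ^ 2 < ⊤) (h1 : ∫⁻ x, ‖iteratedFDeriv ℝ 1 u x‖ₑ ^ 2 < ⊤) :
    ∫ x, max (‖u x‖ - c) 0 / max ‖u x‖ c * ⟪fderiv ℝ u x (u x), u x⟫ = 0 := by
  have hB0 : 0 ≤ B := (norm_nonneg _).trans (hB 0)
  -- the truncated energy density `θ = (|u| - c)₊²` is `C¹`
  set θ : EuclideanSpace ℝ (Fin 3) → ℝ := fun x => (max (‖u x‖ - c) 0) ^ 2 with hθ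
  have hθ1 : ContDiff ℝ 1 θ := (contDiff_one_truncSq hc).comp hu
  have hud : Differentiable ℝ u := hu.differentiable one_ne_zero
  have cu : Continuous u := hu.continuous
  have cDu : Continuous (fderiv ℝ u) := hu.continuous_fderiv one_ne_zero
  have hfθ : ∀ x, fderiv ℝ θ x = ((2 * (max (‖u x‖ - c) 0 / max ‖u x‖ c)) • innerSL ℝ (u x)).comp
      (fderiv ℝ u x) := fun x =>
    ((hasFDerivAt_truncSq hc (u x)).comp x (hud x).hasFDerivAt).fderiv
  have hgrad : ∀ x, ⟪u x, gradient θ x⟫ =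
      2 * (max (‖u x‖ - c) 0 / max ‖u x‖ c * ⟪fderiv ℝ u x (u x), u x⟫) := by
    intro x
    rw [gradient, real_inner_comm, InnerProductSpace.toDual_symm_apply, hfθ x,
      ContinuousLinearMap.comp_apply, FunLike.coe_smul, Pi.smul_apply, innerSL_apply_apply,
      smul_eq_mul, real_inner_comm (u x)]
    ring
  -- `L²` facts
  have l2Du : ∫⁻ x, ‖fderiv ℝ u x‖ₑ ^ 2 < ⊤ :=
    lintegral_enorm_sq_lt_top_of_norm_le (fun x => by
      rw [← norm_iteratedFDeriv_fderiv, norm_iteratedFDeriv_zero]) h1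
  -- real-valued majorants (scalar multiples of operator-valued fields are expensive to elaborate)
  have l2nu : ∫⁻ x, ‖(‖u x‖)‖ₑ ^ 2 < ⊤ :=
    lintegral_enorm_sq_lt_top_of_norm_le (fun x => by rw [norm_norm]) h0
  have l2nDu : ∫⁻ x, ‖(‖fderiv ℝ u x‖)‖ₑ ^ 2 < ⊤ :=
    lintegral_enorm_sq_lt_top_of_norm_le (fun x => by rw [norm_norm]) l2Du
  have l2Bu : ∫⁻ x, ‖B * ‖u x‖‖ₑ ^ 2 < ⊤ := by
    have h := lintegral_enorm_sq_const_smul_lt_top B l2nu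
    simpa only [smul_eq_mul] using h
  have l2BDu : ∫⁻ x, ‖(2 * B) * ‖fderiv ℝ u x‖‖ₑ ^ 2 < ⊤ := by
    have h := lintegral_enorm_sq_const_smul_lt_top (2 * B) l2nDu
    simpa only [smul_eq_mul] using h
  -- hypotheses of the whole-space integration by parts
  have cθu : Continuous fun x => θ x • u x := hθ1.continuous.smul cu
  have cBu : Continuous fun x => B * ‖u x‖ := continuous_const.mul cu.norm
  have cBDu : Continuous fun x => (2 * B) * ‖fderiv ℝ u x‖ := continuous_const.mul cDu.norm
  have hint : Integrable (fun x => θ x • u x) volume := by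
    refine integrable_of_norm_le_mul_of_lintegral_sq (b := fun x => B * ‖u x‖) cθu.aestronglyMeasurable
      cu cBu h0 l2Bu fun x => ?_
    rw [norm_smul, Real.norm_of_nonneg (sq_nonneg _), Real.norm_of_nonneg (by positivity)]
    calc (max (‖u x‖ - c) 0) ^ 2 * ‖u x‖ ≤ ‖u x‖ ^ 2 * ‖u x‖ :=
          mul_le_mul_of_nonneg_right (truncSq_le_norm_sq hc (u x)) (norm_nonneg _)
      _ = ‖u x‖ * (‖u x‖ * ‖u x‖) := by ring
      _ ≤ ‖u x‖ * (B * ‖u x‖) := by gcongr; exact hB x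
  have hdiv0 : Integrable (fun x => θ x * VectorCalculus.divergence u x) volume := by
    have : (fun x => θ x * VectorCalculus.divergence u x) = fun _ => 0 := by
      funext x; rw [hdiv x, mul_zero]
    rw [this]; exact integrable_zero _ _ _
  have cpair : Continuous fun x => ⟪u x, gradient θ x⟫ := cu.inner (continuous_gradient_of_contDiff hθ1)
  have hpair : Integrable (fun x => ⟪u x, gradient θ x⟫) volume := by
    refine integrable_of_norm_le_mul_of_lintegral_sq (b := fun x => (2 * B) * ‖fderiv ℝ u x‖)
      cpair.aestronglyMeasurable cu cBDu h0 l2BDu fun x => ?_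
    have hk0 : 0 ≤ max (‖u x‖ - c) 0 / max ‖u x‖ c := weight_nonneg hc (u x)
    have hk1 : max (‖u x‖ - c) 0 / max ‖u x‖ c ≤ 1 := weight_le_one hc (u x)
    have hin : |⟪fderiv ℝ u x (u x), u x⟫| ≤ ‖fderiv ℝ u x‖ * ‖u x‖ * ‖u x‖ :=
      (abs_real_inner_le_norm _ _).trans
        (mul_le_mul_of_nonneg_right (ContinuousLinearMap.le_opNorm _ _) (norm_nonneg _))
    rw [hgrad x, Real.norm_of_nonneg (by positivity : (0 : ℝ) ≤ 2 * B * ‖fderiv ℝ u x‖),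
      Real.norm_eq_abs, abs_mul, abs_mul, abs_of_nonneg hk0, abs_of_pos two_pos]
    calc 2 * (max (‖u x‖ - c) 0 / max ‖u x‖ c * |⟪fderiv ℝ u x (u x), u x⟫|)
        ≤ 2 * (1 * (‖fderiv ℝ u x‖ * ‖u x‖ * ‖u x‖)) := by
          gcongr
      _ = ‖u x‖ * (2 * ‖fderiv ℝ u x‖) * ‖u x‖ := by ring
      _ ≤ ‖u x‖ * (2 * ‖fderiv ℝ u x‖) * B := by gcongr; exact hB x
      _ = ‖u x‖ * (2 * B * ‖fderiv ℝ u x‖) := by ring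
  have h := integral_mul_divergence_add_eq_zero_of_integrable hθ1 hu hint hdiv0 hpair
  have hz : ∫ x, θ x * VectorCalculus.divergence u x = 0 := by
    refine integral_eq_zero_of_ae (Eventually.of_forall fun x => ?_)
    simp [hdiv x]
  rw [hz, zero_add] at h
  simp_rw [hgrad] at h
  rw [integral_const_mul] at h
  linarith

/-! ### The time balance of the truncated energy -/

/-- **Time balance of the truncated energy** `∫(|u|-c)₊²` (Vasseur 2007, proof of Lemma 11): for
`u` jointly smooth on `[0, T] × ℝ³`, `T > 0`, with `∫‖u(t)‖² ≤ C₀` and `∫‖∂ₜu(t)‖² ≤ C₁` on `[0, T]`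
(`∂ₜu` the one-sided time derivative within `[0, T]`) and `c > 0`: the pairing
`t ↦ ∫ k₀(u)⟪∂ₜu, u⟫` is integrable on `(0, T)` and
`∫(|u(T)|-c)₊² = ∫(|u(0)|-c)₊² + 2∫₀ᵀ∫ k₀(u)⟪∂ₜu, u⟫` (pointwise
`d/dt (|u|-c)₊² = 2k₀(u)⟪∂ₜu, u⟫`, the fundamental theorem of calculus in `t` for each `x`, Fubini). -/
theorem truncSq_balance {c : ℝ} (hc : 0 < c) {T : ℝ} (hT : 0 < T)
    {u : ℝ → EuclideanSpace ℝ (Fin 3) → EuclideanSpace ℝ (Fin 3)}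
    (hu : IsSmoothSpaceTimeOn (Icc 0 T) u) {C₀ C₁ : ℝ≥0}
    (hC₀ : ∀ t ∈ Icc 0 T, ∫⁻ x, ‖u t x‖ₑ ^ 2 ≤ C₀)
    (hC₁ : ∀ t ∈ Icc 0 T, ∫⁻ x, ‖timeDerivWithin (Icc 0 T) u t x‖ₑ ^ 2 ≤ C₁) :
    IntegrableOn (fun t => ∫ x, max (‖u t x‖ - c) 0 / max ‖u t x‖ c *
        ⟪timeDerivWithin (Icc 0 T) u t x, u t x⟫) (Ioo 0 T) ∧
    ∫ x, (max (‖u T x‖ - c) 0) ^ 2 = (∫ x, (max (‖u 0 x‖ - c) 0) ^ 2) +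
      2 * ∫ t in Ioo 0 T, ∫ x, max (‖u t x‖ - c) 0 / max ‖u t x‖ c *
        ⟪timeDerivWithin (Icc 0 T) u t x, u t x⟫ := by
  have hU : UniqueDiffOn ℝ (Icc 0 T) := uniqueDiffOn_Icc hT
  set W : ℝ → EuclideanSpace ℝ (Fin 3) → EuclideanSpace ℝ (Fin 3) := timeDerivWithin (Icc 0 T) u
    with hW
  have hWsm : IsSmoothSpaceTimeOn (Icc 0 T) W := hu.timeDerivWithin hU
  have cw : ContinuousOn (uncurry u) (Icc 0 T ×ˢ univ) := hu.continuousOn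
  have cW : ContinuousOn (uncurry W) (Icc 0 T ×ˢ univ) := hWsm.continuousOn
  have ck : Continuous fun v : EuclideanSpace ℝ (Fin 3) => max (‖v‖ - c) 0 / max ‖v‖ c :=
    continuous_weight hc
  -- the density `g = k₀(u) ⟪W, u⟫`
  obtain ⟨g, hg⟩ : ∃ g : ℝ → EuclideanSpace ℝ (Fin 3) → ℝ,
      g = fun t x => max (‖u t x‖ - c) 0 / max ‖u t x‖ c * ⟪W t x, u t x⟫ := ⟨_, rfl⟩
  have hgt : ∀ t x, g t x = max (‖u t x‖ - c) 0 / max ‖u t x‖ c * ⟪W t x, u t x⟫ := fun t x => by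
    rw [hg]
  have cg : ContinuousOn (uncurry g) (Icc 0 T ×ˢ univ) := by
    rw [hg]; exact (ck.comp_continuousOn cw).mul (cW.inner cw)
  have cwt : ∀ t ∈ Icc 0 T, Continuous (u t) := fun t ht => (hu.contDiff_slice ht).continuous
  have cWt : ∀ t ∈ Icc 0 T, Continuous (W t) := fun t ht => (hWsm.contDiff_slice ht).continuous
  -- space–time integrability of `g`
  have hg_int : Integrable (uncurry g) (((volume : Measure ℝ).restrict (Ioo 0 T)).prod volume) := by
    refine integrable_slab_of_pairing_bound (a := W) (b := u) cg (fun t _ x => ?_) cWt hC₁ hC₀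
    show |g t x| ≤ ‖W t x‖ * ‖u t x‖
    rw [hgt, abs_mul, abs_of_nonneg (weight_nonneg hc _)]
    calc max (‖u t x‖ - c) 0 / max ‖u t x‖ c * |⟪W t x, u t x⟫| ≤ 1 * (‖W t x‖ * ‖u t x‖) := by
          gcongr
          · exact weight_le_one hc _
          · exact abs_real_inner_le_norm _ _
      _ = ‖W t x‖ * ‖u t x‖ := one_mul _
  -- slices of `(|u| - c)₊²` are integrable
  have isq : ∀ t ∈ Icc 0 T, Integrable (fun x => (max (‖u t x‖ - c) 0) ^ 2) volume := by
    intro t ht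
    have h2 : Integrable (fun x => ‖u t x‖ ^ 2) volume :=
      integrable_sq_norm_of_lintegral_lt_top (cwt t ht) ((hC₀ t ht).trans_lt ENNReal.coe_lt_top)
    refine h2.mono' ((differentiable_truncSq hc).continuous.comp (cwt t ht)).aestronglyMeasurable
      (Eventually.of_forall fun x => ?_)
    rw [Real.norm_of_nonneg (sq_nonneg _)]
    exact truncSq_le_norm_sq hc _
  -- pointwise time derivative
  have hderiv : ∀ t ∈ Ioo 0 T, ∀ x, HasDerivAt (fun τ => (max (‖u τ x‖ - c) 0) ^ 2) (2 * g t x) t := by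
    intro t ht x
    have h1 : HasDerivAt (fun τ => u τ x) (W t x) t :=
      (hu.hasDerivWithinAt_timeDerivWithin hU (Ioo_subset_Icc_self ht) x).hasDerivAt
        (Icc_mem_nhds ht.1 ht.2)
    have h2 := (hasFDerivAt_truncSq hc (u t x)).comp_hasDerivAt t h1
    have heq : ((2 * (max (‖u t x‖ - c) 0 / max ‖u t x‖ c)) • innerSL ℝ (u t x)) (W t x) =
        2 * g t x := by
      rw [hgt, FunLike.coe_smul, Pi.smul_apply, innerSL_apply_apply, smul_eq_mul,
        real_inner_comm (u t x)]
      ring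
    rw [heq] at h2
    exact h2
  -- FTC on each time line
  have hFTC : ∀ x, ∫ t in (0 : ℝ)..T, 2 * g t x =
      (max (‖u T x‖ - c) 0) ^ 2 - (max (‖u 0 x‖ - c) 0) ^ 2 := by
    intro x
    have hcl : ContinuousOn (fun τ => ((τ, x) : ℝ × EuclideanSpace ℝ (Fin 3))) (Icc 0 T) :=
      (continuous_id.prodMk continuous_const).continuousOn
    have hmaps : MapsTo (fun τ => ((τ, x) : ℝ × EuclideanSpace ℝ (Fin 3))) (Icc 0 T)
        (Icc 0 T ×ˢ univ) := fun τ hτ => mk_mem_prod hτ (mem_univ x)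
    have hcont : ContinuousOn (fun τ => (max (‖u τ x‖ - c) 0) ^ 2) (Icc 0 T) :=
      (differentiable_truncSq hc).continuous.comp_continuousOn (cw.comp hcl hmaps)
    have hcg : ContinuousOn (fun τ => 2 * g τ x) (Icc 0 T) :=
      continuousOn_const.mul ((cg.comp hcl hmaps).congr fun τ _ => rfl)
    exact intervalIntegral.integral_eq_sub_of_hasDerivAt_of_le (f' := fun τ => 2 * g τ x) hT.le
      hcont (fun t ht => hderiv t ht x) (hcg.intervalIntegrable_of_Icc hT.le)
  -- Fubini
  have hI := hg_int.const_mul 2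
  have hswap := integral_integral_swap (μ := (volume : Measure ℝ).restrict (Ioo 0 T))
    (ν := (volume : Measure (EuclideanSpace ℝ (Fin 3)))) (f := fun t x => 2 * g t x) hI
  have hx : ∫ x, ∫ t in Ioo 0 T, 2 * g t x =
      (∫ x, (max (‖u T x‖ - c) 0) ^ 2) - ∫ x, (max (‖u 0 x‖ - c) 0) ^ 2 := by
    have : (fun x => ∫ t in Ioo 0 T, 2 * g t x) =
        fun x => (max (‖u T x‖ - c) 0) ^ 2 - (max (‖u 0 x‖ - c) 0) ^ 2 := by
      funext x
      rw [← hFTC x, intervalIntegral.integral_of_le hT.le, integral_Ioc_eq_integral_Ioo]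
    rw [this, integral_sub (isq T ⟨hT.le, le_rfl⟩) (isq 0 ⟨le_rfl, hT.le⟩)]
  have h2g : ∫ t in Ioo 0 T, ∫ x, 2 * g t x = 2 * ∫ t in Ioo 0 T, ∫ x, g t x := by
    rw [← integral_const_mul]
    refine integral_congr_ae (Eventually.of_forall fun t => ?_)
    exact integral_const_mul _ _
  refine ⟨?_, ?_⟩
  · have hI : IntegrableOn (fun t => ∫ x, g t x) (Ioo 0 T) volume := hg_int.integral_prod_left
    simp only [hgt] at hI
    exact hI
  · simp only [← hgt]
    rw [← h2g, hswap, hx]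
    ring

end Summit.NavierStokesRegularity.NavierStokesRegularity.Theorems.LevelSetEnergyInequality

end
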